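import Summits.AtomisticToContinuum.HydrodynamicLimit.Theorems.EnskogAdjointDualityCollisionResidualVanishesDefs
import HarnessLib

/-!
# EnskogAdjointDuality / CollisionResidualVanishes — definitions of the reshaped line `birth` (cycle 6):
# K1 on the CUTOFF-dual families

Support file for the crux `Summit.AtomisticToContinuum.HydrodynamicLimit.Theses.EnskogAdjointDuality.CollisionResidualVanishes`
(K1, stmt-AtomisticToContinuum-14658, route `EnskogAdjointDuality`, sub-problem `HydrodynamicLimit`). The sibling crux
`AdjointEnskogTestFamilyR` (K2R) was found false AS TYPED by its line lead (2026-08-17,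
`Cruxes/AdjointEnskogTestFamilyR/HyperVelocityObstruction.md`): its property (iii), the defect bound
`|Dφ^N + L^Nφ^N| ≤ η_N(1+|v|²)` for ALL `v ∈ ℝ³`, is unsatisfiable in the admissible class, so the cycle-4 restatement
candidate `CollisionResidualVanishesDualAt` (K1 restricted to families with (i)–(v) AS TYPED) has, at every non-trivial
terminal datum, no family to speak about. The proposed repair of K2R (R1 there) asks (iii) only for `‖v‖ ≤ N + 1` and adds a
crude global polynomial bound `|Dφ^N + L^Nφ^N| ≤ C_g(1+|v|²)³`. This file DECLARES the corresponding restatement candidate of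
K1 (route-internal Props, not cited facts):

* `CollisionResidualVanishesDualCutAt η₁` — verbatim `CollisionResidualVanishesDualAt η₁` with the premise (ii)∧(iii) replaced
  by its velocity-cutoff form `∃ η_N → 0, ∃ C_g, ∀ᶠ N, (ii) ∧ ((iii) for ‖v‖ ≤ N+1) ∧ (|Dφ^N + L^Nφ^N| ≤ C_g(1+|v|²)³ for all v)`;
* `CollisionResidualVanishesDualCut` — the EOS-window prefix of the route decl, then `CollisionResidualVanishesDualCutAt η₁`;
* `collisionResidualVanishesDualAt_of_dualCutAt` (registered form `dualAt_of_dualCutAt`) — it implies the cycle-4 candidate `CollisionResidualVanishesDualAt` (sanity direction).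

The theorem file `EnskogAdjointDualityCollisionResidualVanishesDualCutCloses.lean` proves `CollisionResidualVanishes →
CollisionResidualVanishesDualCut` (weakening) and, for every EOS window `η₁`,
`HydroLimitInBandAt η₁ → CollisionResidualVanishesDualCutAt η₁` (the cutoff converse duality theorem
`collisionResidual_tendsto_zero_of_tendstoHydroFieldsAt_cut` + `IsHardSphereEulerSolution.restrict` + the tube lemma): a K1
restated to the cutoff-dual families is conjunct-grade (no easier than the hydrodynamic limit at time `t`), K2R-FREE.
References: H. Spohn, Large Scale Dynamics of Interacting Particles (1991), Part I Ch. 3 §3.2 (3.21) [Spohn1991];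
M. Pulvirenti, S. Simonella, arXiv:1504.03215, §2 [PulvirentiSimonella2016]. prover-line-stmt-AtomisticToContinuum-14658-c6-0
(line lead, cycle 6).
-/

noncomputable section

open MeasureTheory Set Filter Topology Function

namespace Summit.AtomisticToContinuum.HydrodynamicLimit.Theorems

open Literature.Analysis.FluidPDE Literature.MathematicalPhysics.KineticTheory
  Literature.Analysis.FunctionSpaces

/-- reshaped-skeleton statement of line birth (cycle 6), crux CollisionResidualVanishes (stmt-AtomisticToContinuum-14658) —
route-internal, not a cited fact. **K1 restricted to the CUTOFF-dual families, at EOS window `η₁`.** Verbatim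
`CollisionResidualVanishesDualAt η₁` (the body of the route decl `CollisionResidualVanishes` after its EOS-window prefix, with
the properties (i)–(v) of the test family inserted as premises before the conclusion), EXCEPT that premise (ii)∧(iii) is in
velocity-cutoff form: eventually in `N`, `C¹` along free flight, defect `|Dφ^N + L^Nφ^N| ≤ η_N(1+|v|²)` for `‖v‖ ≤ N + 1`
with `η_N → 0`, and a global polynomial bound `|Dφ^N + L^Nφ^N| ≤ C_g(1+|v|²)³` (the repair R1 of the refuted-as-typed
`AdjointEnskogTestFamilyR`, `Cruxes/AdjointEnskogTestFamilyR/HyperVelocityObstruction.md` §9). -/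
def CollisionResidualVanishesDualCutAt (η₁ : ℝ) : Prop :=
  ∀ (a₀ θ₀ : UnitAddTorus (Fin 3) → ℝ) (u₀ : UnitAddTorus (Fin 3) → EuclideanSpace ℝ (Fin 3)), Continuous a₀ →
    Continuous θ₀ → Continuous u₀ → (∀ x, 0 < a₀ x) → (∀ x, 0 < θ₀ x) → ∃ σ₀ : ℝ, 0 < σ₀ ∧ ∀ σ : ℝ, 0 < σ →
    σ < σ₀ →
    ∀ (T : ℝ) (ρ θ : ℝ → UnitAddTorus (Fin 3) → ℝ) (u : ℝ → UnitAddTorus (Fin 3) → EuclideanSpace ℝ (Fin 3)), Literature.MathematicalPhysics.KineticTheory.IsHardSphereEulerSolution σ T ρ u θ →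
    ∀ Φ : (N : ℕ) →
    Literature.Analysis.FluidPDE.HardSphereFlow (Literature.Analysis.FluidPDE.Torus.geometry (Fin 3)) (Literature.MathematicalPhysics.KineticTheory.hsDiameter σ N) (N + 1), Literature.MathematicalPhysics.KineticTheory.TendstoHydroFieldsAt (fun N => Literature.MathematicalPhysics.KineticTheory.localGibbsLaw σ a₀ u₀ θ₀ N (Φ N)) Φ ρ u θ 0 →
    ∀ t ∈ Set.Ico 0 T, (∀ s ∈ Set.Icc 0 t, ∀ x, ρ s x * σ ^ 3 < η₁) →
    ∀ (c : ℕ → ℝ → UnitAddTorus (Fin 3) → ℝ × EuclideanSpace ℝ (Fin 3) × ℝ) (κ : ℕ → ℝ → UnitAddTorus (Fin 3) → EuclideanSpace ℝ (Fin 3) → ℝ), (∀ N, Continuous (Function.uncurry (c N))) →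
    (∀ N, Continuous (fun p : ℝ × UnitAddTorus (Fin 3) × EuclideanSpace ℝ (Fin 3) => κ N p.1 p.2.1 p.2.2)) →
    (∃ C : ℝ, ∀ N s x x' v v', ‖c N s x‖ ≤ C ∧ dist (c N s x) (c N s x') ≤ C * dist x x' ∧ |κ N s x v| ≤ C * (1 + ‖v‖ ^ 2) ∧ |κ N s x v - κ N s x' v'| ≤ C * (1 + ‖v‖ ^ 2 + ‖v'‖ ^ 2) * (dist x x' + ‖v - v'‖)) →
    let G := Literature.Analysis.FluidPDE.Torus.geometry (Fin 3)
    let ε := fun N : ℕ => Literature.MathematicalPhysics.KineticTheory.hsDiameter σ N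
    let lam := fun N : ℕ => (N : ℝ) * ε N ^ 2
    let f := fun (s : ℝ) (x : UnitAddTorus (Fin 3)) (v : EuclideanSpace ℝ (Fin 3)) => ρ s x * Literature.Analysis.FluidPDE.localMaxwellian 1 (θ s x) (u s x) v
    let Y := fun η : ℝ => 3 / (2 * Real.pi) * deriv Literature.MathematicalPhysics.KineticTheory.hsExcessFreeEnergy η
    let φ := fun (N : ℕ) (s : ℝ) (x : UnitAddTorus (Fin 3)) (v : EuclideanSpace ℝ (Fin 3)) => (c N s x).1 + inner ℝ (c N s x).2.1 v + (c N s x).2.2 * ‖v‖ ^ 2 / 2 + (lam N)⁻¹ * κ N s x v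
    let L := fun (N : ℕ) (s : ℝ) (x : UnitAddTorus (Fin 3)) (v : EuclideanSpace ℝ (Fin 3)) => lam N * ∫ ω : Metric.sphere (0 : EuclideanSpace ℝ (Fin 3)) 1, (let y := G.translate x (ε N • (ω : EuclideanSpace ℝ (Fin 3))); ∫ w : EuclideanSpace ℝ (Fin 3), max (inner ℝ (v - w) ω) 0 * Y (σ ^ 3 * ρ s (G.translate x ((ε N / 2) • (ω : EuclideanSpace ℝ (Fin 3))))) * f s y w * (φ N s x (v - inner ℝ (v - w) ω • (ω : EuclideanSpace ℝ (Fin 3))) + φ N s y (w + inner ℝ (v - w) ω • (ω : EuclideanSpace ℝ (Fin 3))) - φ N s x v - φ N s y w)) ∂Literature.MathematicalPhysics.KineticTheory.sphereMeasure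
    let R := fun (N : ℕ) (z : Literature.Analysis.FluidPDE.Config (N + 1) (Fin 3) (UnitAddTorus (Fin 3))) => (let q := fun r : ℝ => (Φ N).flow r z; (N + 1 : ℝ)⁻¹ * (∑ᶠ (s : ℝ) (_ : s ∈ Literature.Analysis.FluidPDE.collisionTimes G (ε N) q ∩ Set.Ioc 0 t), ∑ i, ∑ j, (if i ≠ j ∧ ‖G.sepVec (q s i).1 (q s j).1‖ = ε N then φ N s (q s i).1 (q s i).2 - φ N s (q s i).1 (Literature.Analysis.FluidPDE.reflectVel (G.sepVec (q s i).1 (q s j).1) ((q s i).2, (q s j).2)).1 else 0)) - (∫ s in Set.Icc 0 t, ∫ y, L N s y.1 y.2 ∂(Literature.Analysis.FluidPDE.empiricalMeasure (q s))) + (1 / 2 : ℝ) * ∫ s in Set.Icc 0 t, ∫ x : UnitAddTorus (Fin 3), ∫ v : EuclideanSpace ℝ (Fin 3), f s x v * L N s x v)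
    ∀ χ : UnitAddTorus (Fin 3) → ℝ, Literature.Analysis.FunctionSpaces.Torus.IsSmooth χ →
    ∀ (a e : ℝ) (b : EuclideanSpace ℝ (Fin 3)),
    (∀ N x v, φ N t x v = χ x * (a + inner ℝ b v + e * ‖v‖ ^ 2 / 2)) →
    (∃ η : ℕ → ℝ, Filter.Tendsto η Filter.atTop (nhds 0) ∧ ∃ Cg : ℝ, ∀ᶠ N in Filter.atTop, (∀ x v, ContDiffOn ℝ 1 (fun r => φ N r (G.translate x (r • v)) v) (Set.Icc 0 t)) ∧ (∀ s ∈ Set.Icc 0 t, ∀ x v, ‖v‖ ≤ (N : ℝ) + 1 → |derivWithin (fun r => φ N r (G.translate x ((r - s) • v)) v) (Set.Icc 0 t) s + L N s x v| ≤ η N * (1 + ‖v‖ ^ 2)) ∧ (∀ s ∈ Set.Icc 0 t, ∀ x v, |derivWithin (fun r => φ N r (G.translate x ((r - s) • v)) v) (Set.Icc 0 t) s + L N s x v| ≤ Cg * (1 + ‖v‖ ^ 2) ^ 3)) →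
    (∃ c₀ : UnitAddTorus (Fin 3) → ℝ × EuclideanSpace ℝ (Fin 3) × ℝ, Continuous c₀ ∧ ∀ δ : ℝ, 0 < δ → ∀ᶠ N in Filter.atTop, ∀ x, dist (c N 0 x) (c₀ x) ≤ δ) →
    Filter.Tendsto (fun N : ℕ => (∫ x : UnitAddTorus (Fin 3), ∫ v : EuclideanSpace ℝ (Fin 3), f t x v * φ N t x v) - (∫ x : UnitAddTorus (Fin 3), ∫ v : EuclideanSpace ℝ (Fin 3), f 0 x v * φ N 0 x v) - ∫ s in Set.Icc 0 t, ∫ x : UnitAddTorus (Fin 3), ∫ v : EuclideanSpace ℝ (Fin 3), f s x v * (derivWithin (fun r => φ N r (G.translate x ((r - s) • v)) v) (Set.Icc 0 t) s + (1 / 2 : ℝ) * L N s x v)) Filter.atTop (nhds 0) →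
    Filter.Tendsto (fun N : ℕ => ∫⁻ z, ENNReal.ofReal (R N z ^ 2) ∂(Literature.MathematicalPhysics.KineticTheory.localGibbsLaw σ a₀ u₀ θ₀ N (Φ N))) Filter.atTop (nhds 0)


/-- reshaped-skeleton statement of line birth (cycle 6), crux CollisionResidualVanishes (stmt-AtomisticToContinuum-14658) —
route-internal, not a cited fact. **The cutoff-dual restatement candidate K1′**: the EOS-window prefix of
`CollisionResidualVanishes` verbatim (`∀ η₁ > 0`, `f_ex` analytic on `(0,η₁)` with `f_ex′ > 0` and `(ηZ)′ > 0`), then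
`CollisionResidualVanishesDualCutAt η₁`. -/
def CollisionResidualVanishesDualCut : Prop :=
  ∀ η₁ : ℝ, 0 < η₁ →
    AnalyticOnNhd ℝ Literature.MathematicalPhysics.KineticTheory.hsExcessFreeEnergy (Set.Ioo 0 η₁) →
    (∀ η ∈ Set.Ioo 0 η₁, 0 < deriv Literature.MathematicalPhysics.KineticTheory.hsExcessFreeEnergy η) →
    (∀ η ∈ Set.Ioo 0 η₁, 0 < deriv (fun x : ℝ => x * Literature.MathematicalPhysics.KineticTheory.hsCompressibility x) η) →
    CollisionResidualVanishesDualCutAt η₁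

/-- **The cutoff-dual candidate implies the cycle-4 candidate** (sanity direction, window by window): a family that is
approximately dual for ALL `v` (premise of `CollisionResidualVanishesDualAt`) is in particular approximately dual below the
cutoff, and its defect is globally bounded by `(1+|v|²)³` once `η_N ≤ 1`; so K1's conclusion granted on the cutoff-dual
families gives it on the dual families. (The converse fails in substance: by the hyper-velocity obstruction no family
satisfies the ∀`v` premise at a non-trivial datum.) [cite: PulvirentiSimonella2016, §2] -/
theorem collisionResidualVanishesDualAt_of_dualCutAt {η₁ : ℝ} (h : CollisionResidualVanishesDualCutAt η₁) :
    CollisionResidualVanishesDualAt η₁ := by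
  intro a₀ θ₀ u₀ ha hθ hu ha0 hθ0
  obtain ⟨σ₀, hσ₀, H⟩ := h a₀ θ₀ u₀ ha hθ hu ha0 hθ0
  refine ⟨σ₀, hσ₀, ?_⟩
  intro σ hσ hσlt T ρ θ u hEul Φ hLLN t ht hg c κ hc hκ hadm G ε lam f Y φ L R χ hχ a e b h1 h2 h3 h4
  refine H σ hσ hσlt T ρ θ u hEul Φ hLLN t ht hg c κ hc hκ hadm χ hχ a e b h1 ?_ h3 h4
  obtain ⟨η, hη, hev⟩ := h2
  refine ⟨η, hη, 1, ?_⟩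
  have hη1 : ∀ᶠ N in Filter.atTop, η N ≤ 1 := by
    have := (Metric.tendsto_nhds.1 hη) 1 one_pos
    exact this.mono fun N hN => by
      have h' : |η N| < 1 := by simpa [Real.dist_eq] using hN
      exact (le_abs_self _).trans h'.le
  filter_upwards [hev, hη1] with N hN hN1
  obtain ⟨hC1, hdef⟩ := hN
  refine ⟨hC1, fun s hs x v _ => hdef s hs x v, fun s hs x v => (hdef s hs x v).trans ?_⟩
  have h1v : (1 : ℝ) ≤ 1 + ‖v‖ ^ 2 := by nlinarith [sq_nonneg ‖v‖]
  have hη0 : 0 ≤ η N := by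
    have h0 := (abs_nonneg _).trans (hdef s hs x v)
    exact nonneg_of_mul_nonneg_left (h0) (by positivity)
  calc η N * (1 + ‖v‖ ^ 2) ≤ 1 * (1 + ‖v‖ ^ 2) := mul_le_mul_of_nonneg_right hN1 (by positivity)
    _ ≤ 1 * (1 + ‖v‖ ^ 2) ^ 3 := by
        rw [one_mul, one_mul]
        calc (1 + ‖v‖ ^ 2) = (1 + ‖v‖ ^ 2) ^ 1 := (pow_one _).symm
          _ ≤ (1 + ‖v‖ ^ 2) ^ 3 := pow_le_pow_right₀ h1v (by norm_num)

/-- **Registered form** (sub-goal `dualAt_of_dualCutAt` of the crux stmt-AtomisticToContinuum-14658, line `birth`): `collisionResidualVanishesDualAt_of_dualCutAt` as a closed `∀`-statement — the cutoff-dual candidate implies the cycle-4 dual candidate, window by window. [cite: PulvirentiSimonella2016, §2] -/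
theorem dualAt_of_dualCutAt : ∀ {η₁ : ℝ} (h : CollisionResidualVanishesDualCutAt η₁), CollisionResidualVanishesDualAt η₁ :=
  @collisionResidualVanishesDualAt_of_dualCutAt

end Summit.AtomisticToContinuum.HydrodynamicLimit.Theorems

end
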